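import Literature.NumberTheory.Automorphic.MirabolicTowerGroups
import HarnessLib

/-!
# The coset tower `N_{d+1} \ GL_{d+1} ≃ ⨆_{P_{d+1} \ GL_{d+1}} N_d \ GL_d` over a field
(Cogdell, *Analytic theory of L-functions for GL_n* (2004), §1.1, proof of Thm. 1.1: the induction
over the mirabolics `P_n ⊃ P_{n-1} ⊃ ⋯` which assembles `∑_{P_{n-1}\GL_{n-1}} ∑_{P_{n-2}\GL_{n-2}} ⋯`
into `∑_{N_{n-1}(k) \ GL_{n-1}(k)}`)

Topic `NumberTheory/Automorphic`; namespace `Literature.NumberTheory.Automorphic`. Pure group theory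
of `GL_{d+1}` over a field `F` (on `MirabolicOrbit`, `MirabolicTowerInvariance`, `MirabolicTowerGroups`
for the mirabolic `P_{d+1} = mirabolic d F`, the corner `glCorner : GL_d → GL_{d+1}` and the column
unipotents `colUnipotent`), isolated for the assembly of the pointwise Fourier–Whittaker expansion of
cusp forms on `GL_n` (Cogdell (2004), Thm. 1.1): the right cosets of the upper unitriangular group
`N_{d+1}(F)` in `GL_{d+1}(F)` are parametrised by a right coset `P_{d+1} s` of the mirabolic together
with a right coset `N_d γ` in the corner, through `(P s, N_d γ) ↦ N_{d+1} diag(γ, 1) s`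
(`P_{d+1} = GL_d ⋉ U_{d+1}`, `N_{d+1} = N_d ⋉ U_{d+1}`). Everything is proved:

* `upperUnitriangular_le_mirabolic` — `N_{d+1} ≤ P_{d+1}`;
* `glCorner_mem_upperUnitriangular_iff` — `diag(a, 1) ∈ N_{d+1} ↔ a ∈ N_d`;
* `exists_colUnipotent_mul_glCorner_eq_of_mem_mirabolic` — **`P_{d+1} = U_{d+1} · diag(GL_d, 1)`**:
  every `p ∈ P_{d+1}(F)` is `u(v) diag(a, 1)` with `v` the last column of `p` and `a` its corner
  (`exists_glCorner_eq_of_cornerForm` applied to `u(-v) p`);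
* `apply_out_mk_eq_of_forall_mul_mem` — a function constant on right cosets takes the same value at
  `Quotient.out` of the class of `a` as at `a`;
* `exists_equiv_sigma_unipotentQuotient` (**main**) — there is a bijection
  `e : (P_{d+1}\GL_{d+1}) × (N_d\GL_d) ≃ N_{d+1}\GL_{d+1}` (Mathlib right-coset spaces
  `Quotient (QuotientGroup.rightRel _)`, a `Σ`-type) with `e (q, γ) = [diag(γ.out, 1) q.out]`
  for the chosen representatives.

No definition is introduced (the bijection is packaged existentially).

## References

* J. W. Cogdell, in J. Bernstein, S. Gelbart (eds.), *An Introduction to the Langlands Program*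
  (2004), §1.1, proof of Thm. 1.1 [CogdellAnalyticTheory2004].
-/

noncomputable section

open Literature.LinearAlgebra.Matrix
open scoped MatrixGroups

namespace Literature.NumberTheory.Automorphic

/-! ### Functions on right-coset spaces -/

section RightCoset

variable {G : Type*} [Group G] (H : Subgroup G)

/-- **A function constant on right cosets `H a` has the same value at the chosen representative of
the coset of `a` as at `a`.** [folklore] -/
theorem apply_out_mk_eq_of_forall_mul_mem {M : Sort*} {f : G → M}
    (hf : ∀ u ∈ H, ∀ g : G, f (u * g) = f g) (a : G) :
    f (Quotient.mk (QuotientGroup.rightRel H) a).out = f a := by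
  have h : a * ((Quotient.mk (QuotientGroup.rightRel H) a).out)⁻¹ ∈ H :=
    QuotientGroup.rightRel_apply.1 (Quotient.mk_out (s := QuotientGroup.rightRel H) a)
  have e : a = (a * ((Quotient.mk (QuotientGroup.rightRel H) a).out)⁻¹) *
      (Quotient.mk (QuotientGroup.rightRel H) a).out := by group
  conv_rhs => rw [e]
  rw [hf _ h]

/-- Two elements define the same right coset iff they differ by an element of `H` on the left.
[folklore] -/
theorem rightRel_mk_eq_mk_iff (a b : G) :
    Quotient.mk (QuotientGroup.rightRel H) a = Quotient.mk (QuotientGroup.rightRel H) b ↔ b * a⁻¹ ∈ H :=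
  ⟨fun h => QuotientGroup.rightRel_apply.1 (Quotient.exact h),
    fun h => Quotient.sound (QuotientGroup.rightRel_apply.2 h)⟩

end RightCoset

/-! ### The mirabolic, the corner and the unitriangular groups of `GL_{d+1}` -/

section Field

variable {F : Type*} [Field F] {d : ℕ}

/-- **`N_{d+1} ≤ P_{d+1}`**: an upper unitriangular matrix has last row `(0, …, 0, 1)`. [folklore] -/
theorem upperUnitriangular_le_mirabolic : upperUnitriangular (Fin (d + 1)) F ≤ mirabolic d F := by
  intro u hu
  rw [mem_mirabolic_iff_row]
  obtain ⟨ht, hdg⟩ := (mem_upperUnitriangular_iff u).1 hu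
  intro j
  by_cases hj : j = Fin.last d
  · rw [if_pos hj, hj]
    exact hdg _
  · rw [if_neg hj]
    exact ht (show id j < id (Fin.last d) from lt_of_le_of_ne (Fin.le_last j) hj)

/-- The corner entries of `diag(a, 1)` are those of `a`. [folklore] -/
theorem glCorner_apply_castSucc (a : GL (Fin d) F) (i j : Fin d) :
    ((glCorner F (Nat.le_succ d) a : GL (Fin (d + 1)) F) : Matrix (Fin (d + 1)) (Fin (d + 1)) F)
        (Fin.castSucc i) (Fin.castSucc j) = (a : Matrix (Fin d) (Fin d) F) i j := by
  rw [glCorner_apply_val, dif_pos (by simp [i.2] : ((Fin.castSucc i : Fin (d + 1)) : ℕ) < d),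
    dif_pos (by simp [j.2] : ((Fin.castSucc j : Fin (d + 1)) : ℕ) < d)]
  rfl

/-- **`diag(a, 1) ∈ N_{d+1} ↔ a ∈ N_d`**. [folklore] -/
theorem glCorner_mem_upperUnitriangular_iff (a : GL (Fin d) F) :
    glCorner F (Nat.le_succ d) a ∈ upperUnitriangular (Fin (d + 1)) F ↔
      a ∈ upperUnitriangular (Fin d) F := by
  refine ⟨fun h => ?_, glCorner_mem_upperUnitriangular _⟩
  obtain ⟨ht, hdg⟩ := (mem_upperUnitriangular_iff _).1 h
  rw [mem_upperUnitriangular_iff]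
  refine ⟨fun i j hij => ?_, fun i => ?_⟩
  · rw [← glCorner_apply_castSucc]
    exact ht (show id (Fin.castSucc j) < id (Fin.castSucc i) from Fin.castSucc_lt_castSucc_iff.2 hij)
  · rw [← glCorner_apply_castSucc]
    exact hdg _

/-- **`P_{d+1} = U_{d+1} · diag(GL_d, 1)`**: every element `p` of the mirabolic is
`u(v) · diag(a, 1)` with `u(v)` the column unipotent on the last column `v` of `p` and `a ∈ GL_d(F)`
its corner block (`u(-v) p` is in corner form, `exists_glCorner_eq_of_cornerForm`). [folklore] -/
theorem exists_colUnipotent_mul_glCorner_eq_of_mem_mirabolic {p : GL (Fin (d + 1)) F}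
    (hp : p ∈ mirabolic d F) :
    ∃ (v : Fin d → F) (a : GL (Fin d) F),
      colUnipotent (d + 1) (Nat.le_succ d) (Multiplicative.ofAdd v) * glCorner F (Nat.le_succ d) a = p := by
  set v : Fin d → F := fun i => (p : Matrix (Fin (d + 1)) (Fin (d + 1)) F) (Fin.castSucc i) (Fin.last d)
    with hv
  set δ₀ : GL (Fin (d + 1)) F := colUnipotent (d + 1) (Nat.le_succ d) (Multiplicative.ofAdd (-v)) * p
    with hδ₀
  have hrow := mem_mirabolic_iff_row.1 hp
  -- the entries of `u(-v) p`
  have hentry : ∀ i j : Fin (d + 1), (δ₀ : Matrix (Fin (d + 1)) (Fin (d + 1)) F) i j =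
      (p : Matrix (Fin (d + 1)) (Fin (d + 1)) F) i j +
        (if hi : (i : ℕ) < d then
          -v ⟨i, hi⟩ * (p : Matrix (Fin (d + 1)) (Fin (d + 1)) F) (Fin.last d) j else 0) := by
    intro i j
    rw [hδ₀, Units.val_mul, Matrix.mul_apply]
    simp_rw [colUnipotent_apply_val, add_mul, Finset.sum_add_distrib]
    congr 1
    · simp only [ite_mul, one_mul, zero_mul, Finset.sum_ite_eq, Finset.mem_univ, if_true]
    · by_cases hi : (i : ℕ) < d
      · simp only [dif_pos hi]
        rw [Finset.sum_eq_single (Fin.last d)]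
        · rw [if_pos (by simp)]
          rfl
        · intro k _ hk
          rw [if_neg, zero_mul]
          intro hkd
          exact hk (Fin.ext (by simp [hkd]))
        · intro h; exact absurd (Finset.mem_univ _) h
      · simp only [dif_neg hi, zero_mul, Finset.sum_const_zero]
  have hform : ∀ i j : Fin (d + 1), ¬ ((i : ℕ) < d ∧ (j : ℕ) < d) →
      (δ₀ : Matrix (Fin (d + 1)) (Fin (d + 1)) F) i j = if i = j then 1 else 0 := by
    intro i j hij
    rw [hentry]
    by_cases hi : (i : ℕ) < d
    · -- then `j = last`
      have hj : j = Fin.last d := Fin.ext (by have := j.2; simp; omega)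
      have hne : i ≠ j := by rw [hj]; intro e; rw [e] at hi; simp at hi
      rw [dif_pos hi, if_neg hne, hj, hrow, if_pos rfl, mul_one]
      have : (⟨(i : ℕ), hi⟩ : Fin d).castSucc = i := Fin.ext rfl
      rw [hv]
      simp only
      rw [this, add_neg_cancel]
    · -- then `i = last`
      have hi' : i = Fin.last d := Fin.ext (by have := i.2; simp; omega)
      rw [dif_neg hi, add_zero, hi', hrow]
      by_cases hj : j = Fin.last d
      · rw [if_pos hj, hj, if_pos rfl]
      · rw [if_neg hj, if_neg (Ne.symm hj)]
  obtain ⟨a, ha⟩ := exists_glCorner_eq_of_cornerForm (Nat.le_succ d) δ₀ hform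
  refine ⟨v, a, ?_⟩
  rw [ha, hδ₀, ← mul_assoc, ← map_mul, ← ofAdd_add, add_neg_cancel, ofAdd_zero, map_one, one_mul]

/-- **The coset tower** (Cogdell (2004), proof of Thm. 1.1): there is a bijection between the pairs
(right coset `P_{d+1}(F) s` of the mirabolic in `GL_{d+1}(F)`, right coset `N_d(F) γ` in `GL_d(F)`)
and the right cosets of `N_{d+1}(F)` in `GL_{d+1}(F)`, sending `(q, γ)` to the coset of
`diag(γ.out, 1) · q.out` for Mathlib's chosen representatives (`P_{d+1} = U_{d+1} ⋊ diag(GL_d, 1)`,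
`N_{d+1} = U_{d+1} ⋊ diag(N_d, 1)`; injectivity: `N_{d+1} ≤ P_{d+1}` and
`diag(a, 1) ∈ N_{d+1} ↔ a ∈ N_d`; surjectivity: `exists_colUnipotent_mul_glCorner_eq_of_mem_mirabolic`).
[cite: CogdellAnalyticTheory2004, Thm. 1.1] -/
theorem exists_equiv_sigma_unipotentQuotient (F : Type*) [Field F] (d : ℕ) :
    ∃ e : (Σ _ : Quotient (QuotientGroup.rightRel (mirabolic d F)),
        Quotient (QuotientGroup.rightRel (upperUnitriangular (Fin d) F))) ≃
        Quotient (QuotientGroup.rightRel (upperUnitriangular (Fin (d + 1)) F)),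
      ∀ (q : Quotient (QuotientGroup.rightRel (mirabolic d F)))
        (γ : Quotient (QuotientGroup.rightRel (upperUnitriangular (Fin d) F))),
        e ⟨q, γ⟩ = Quotient.mk _ (glCorner F (Nat.le_succ d) γ.out * q.out) := by
  set N : Subgroup (GL (Fin (d + 1)) F) := upperUnitriangular (Fin (d + 1)) F with hN
  set Nd : Subgroup (GL (Fin d) F) := upperUnitriangular (Fin d) F with hNd
  set P : Subgroup (GL (Fin (d + 1)) F) := mirabolic d F with hP
  set f : (Σ _ : Quotient (QuotientGroup.rightRel P), Quotient (QuotientGroup.rightRel Nd)) →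
      Quotient (QuotientGroup.rightRel N) :=
    fun s => Quotient.mk _ (glCorner F (Nat.le_succ d) s.2.out * s.1.out) with hf
  refine ⟨Equiv.ofBijective f ⟨?_, ?_⟩, fun q γ => rfl⟩
  · -- injective
    rintro ⟨q₁, γ₁⟩ ⟨q₂, γ₂⟩ h
    have hu : glCorner F (Nat.le_succ d) γ₂.out * q₂.out * (glCorner F (Nat.le_succ d) γ₁.out * q₁.out)⁻¹ ∈ N :=
      (rightRel_mk_eq_mk_iff N _ _).1 h
    -- the mirabolic cosets agree
    have hq : q₁ = q₂ := by
      rw [← Quotient.out_equiv_out]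
      refine QuotientGroup.rightRel_apply.2 ?_
      have e : q₂.out * q₁.out⁻¹ = (glCorner F (Nat.le_succ d) γ₂.out)⁻¹ *
          (glCorner F (Nat.le_succ d) γ₂.out * q₂.out * (glCorner F (Nat.le_succ d) γ₁.out * q₁.out)⁻¹) *
          glCorner F (Nat.le_succ d) γ₁.out := by group
      rw [e]
      exact P.mul_mem (P.mul_mem (P.inv_mem (glCorner_mem_mirabolic _))
        (upperUnitriangular_le_mirabolic hu)) (glCorner_mem_mirabolic _)
    subst hq
    -- then the corner cosets agree
    have hγ : γ₁ = γ₂ := by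
      rw [← Quotient.out_equiv_out]
      refine QuotientGroup.rightRel_apply.2 ?_
      rw [← glCorner_mem_upperUnitriangular_iff, map_mul, map_inv]
      have e : glCorner F (Nat.le_succ d) γ₂.out * (glCorner F (Nat.le_succ d) γ₁.out)⁻¹ =
          glCorner F (Nat.le_succ d) γ₂.out * q₁.out * (glCorner F (Nat.le_succ d) γ₁.out * q₁.out)⁻¹ := by
        group
      rw [e]
      exact hu
    subst hγ
    rfl
  · -- surjective
    intro Q
    induction Q using Quotient.inductionOn with
    | h γ =>
      set q : Quotient (QuotientGroup.rightRel P) := Quotient.mk _ γ with hq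
      -- `γ = p · q.out` with `p` in the mirabolic
      have hp : γ * q.out⁻¹ ∈ P :=
        QuotientGroup.rightRel_apply.1 (Quotient.mk_out (s := QuotientGroup.rightRel P) γ)
      obtain ⟨v, a, hva⟩ := exists_colUnipotent_mul_glCorner_eq_of_mem_mirabolic hp
      refine ⟨⟨q, Quotient.mk _ a⟩, ?_⟩
      change Quotient.mk _ (glCorner F (Nat.le_succ d) (Quotient.mk (QuotientGroup.rightRel Nd) a).out * q.out) =
        Quotient.mk _ γ
      refine (rightRel_mk_eq_mk_iff N _ _).2 ?_
      -- `a · (out of its class)⁻¹ ∈ N_d`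
      have ha : a * ((Quotient.mk (QuotientGroup.rightRel Nd) a).out)⁻¹ ∈ Nd :=
        QuotientGroup.rightRel_apply.1 (Quotient.mk_out (s := QuotientGroup.rightRel Nd) a)
      have e : γ * (glCorner F (Nat.le_succ d) (Quotient.mk (QuotientGroup.rightRel Nd) a).out * q.out)⁻¹ =
          (γ * q.out⁻¹) * (glCorner F (Nat.le_succ d) (Quotient.mk (QuotientGroup.rightRel Nd) a).out)⁻¹ := by
        group
      rw [e, ← hva, mul_assoc, ← map_inv, ← map_mul]
      exact N.mul_mem (unipotentColRange_le_upperUnitriangular (colUnipotent_mem_unipotentColRange _ v))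
        ((glCorner_mem_upperUnitriangular_iff _).2 ha)

end Field

end Literature.NumberTheory.Automorphic
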